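import Summits.QuantumFields.YangMills.Theorems.UnitScaleTiltProp7TorusCentreChains
import HarnessLib

/-!
# Route `UnitScaleTilt`, crux K1 «MinimiserStabilityRegPr» (stmt-QuantumFields-19200), route-R (β) R0 REM2ˢ «(n3)₂-sym» = H2-1ˢ, px21 g7's N-line, file N2′ part 2 —
# THE NESTED SUPPORT FAMILY OF A TOP SITE `z ∈ T^{(j+1)}`: `C^z_i := {b ∈ bonds of T^{(i)} : ∀ κ, d(b₋, centre_i(z))_κ ≤ L^{j+1−i} − 2}` — TOP, NESTING (= N1 §2's `hC`),
# LEVEL-0 BALL (the shape N4 reads), and MULTIPLICITY `≤ 2^d` with its overlap sum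

Cell `ym3-torus`, width seat `ym-ust-19200-w5` (gen 8); px21 g7 N-LINE NAMER WORD №1∕№2 (2026-08-29) «N2′ → w5 g8», letters INLINE as asked (`((b.src κ − centre κ).valMinAbs).natAbs`,
centre label `(z κ).val·L^{j+1−i} + (L^{j+1−i}−1)∕2`).  RADIUS OF RECORD `s r := L^{r+1} − 2` (`r = j − i`): a CLOSED FORM satisfying the located recursion as inequalities
(`(L−1)∕2 ≤ s 0`, `L·(s r + 1) + (L−1)∕2 ≤ s (r+1)` for odd `L ≥ 3`), so the level-0 bound `≤ L^{j+1} − 2` is definitional and the spacing argument of the multiplicity is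
`2(L^{j+1−i} − 2) + 1 < 2·L^{j+1−i}`.  THEOREMS ONLY (0 `def`, 0 `sorry`); `--supports stmt-QuantumFields-19200 --as helper`, count-neutral.  Generic `Params`.  YM₃ on T³ is a
ladder rung (R3), not the Clay problem; nothing here claims `hN2s`, H2-1, (β), the stub, the crux, d = 4 or the mass gap.

WHAT IS PROVED (ns `…Theorems.Prop7TrueLinSparseSupport`; the family written out as a `univ.filter` at every occurrence).
* §1 ★`mem_family_top` — `blockOf b.src = z → b ∈ C^z_j`; ★★`mem_family_of_mem_succ` — `c ∈ C^z_{i+1} → (blockOf b.src = c.src ∨ blockOf b.src = c.tgt) → b ∈ C^z_i` (`i + 1 ≤ j`):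
  the two-block neighbourhood closure that ✓p708624 §2 (`hC`) ∕ ✓p708296 (`hnest`) ask, by the triangle inequality through `emb (blockOf b.src)` and the `emb`-scaling of part 1.
* §2 `natAbs_valMinAbs_sub_embIter_le_of_mem_family_zero` — `b ∈ C^z_0 → ∀ κ, d(b₋, embIter (j+1) z)_κ ≤ L^{j+1} − 2` (N4's ball, lit `B15DeterminingSets.embIter`).
* §3 ★`card_filter_near_centre_le_two` (one coordinate: at most two centres `vM + (M−1)∕2`, `M = L^{j+1−i}`, within `M − 2` of a point — `v ∈ {q, q ∓ 1}`, `q = x.val ∕ M`),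
  ★`card_filter_mem_family_le` (`#{z : b ∈ C^z_i} ≤ 2^d`, product over coordinates via `Fintype.piFinset`), ★★`sum_sum_family_le` (`Σ_z Σ_{b ∈ C^z_i} g b ≤ 2^d·Σ_b g b`, `g ≥ 0`).
HONEST SCOPE.  Lattice bookkeeping; no analysis; the choice of the radii is this file's (larger than the minimal recursion, same exponent count downstream up to the constant
`((2(L^{j+1}−2)+1)∕L^{l})^d`).  [folklore] over [Balaban1987RG1] (0.1)–(0.3) pp.251–252 and [Balaban1983RegularityDecay] (1.4) p.572.
-/

set_option autoImplicit false

namespace Summit.QuantumFields.YangMills.Theorems.Prop7TrueLinSparseSupport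

open Literature.MathematicalPhysics.QuantumFieldTheory.Balaban1983to89
open Finset
open Summit.QuantumFields.YangMills.Theorems.Prop7TorusCentreChains

variable {P : Params}

/-! ## §1 The nested support family of a top site: `C^z_i = {b : ∀ κ, d(b₋, centre_i(z))_κ ≤ L^{j+1−i} − 2}` — TOP and NESTING -/

/-- ★ **TOP**: every bond issuing from the block `B(z)` lies in `C^z_j` (radius `L − 2 ≥ (L−1)∕2` for `L ≥ 3`; the level-`j` centre of `z` is `emb z`).
[cite: Balaban1987RG1, (0.3) p.252] -/
theorem mem_family_top {j : ℕ} (hj : j + 1 ≤ P.m + P.K) (z : Site P (j + 1)) (b : PBond P j) (hb : blockOf b.src = z) :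
    b ∈ univ.filter (fun b : PBond P j => ∀ κ, ((b.src κ -
        (((z κ).val * P.L ^ (j + 1 - j) + (P.L ^ (j + 1 - j) - 1) / 2 : ℕ) : ZMod (P.sitesPerDir j))).valMinAbs).natAbs ≤ P.L ^ (j + 1 - j) - 2) := by
  rw [Finset.mem_filter]
  refine ⟨Finset.mem_univ _, fun κ => ?_⟩
  rw [show j + 1 - j = 1 by omega, pow_one]
  have h := natAbs_valMinAbs_sub_emb_blockOf_le hj b.src κ
  rw [hb] at h
  have he : emb z κ = (((z κ).val * P.L + (P.L - 1) / 2 : ℕ) : ZMod (P.sitesPerDir j)) := rfl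
  rw [he] at h
  have hL' := AveragingRT.two_mul_half_add_one P
  omega

/-- ★ **NESTING** (= N1 §2's `hC` token for token): if `c ∈ C^z_{i+1}` and `b` issues from `B(c₋) ∪ B(c₊)`, then `b ∈ C^z_i` (`i + 1 ≤ j`, `L ≥ 3`):
`d ≤ (L−1)∕2 + L·(1 + (L^{j−i} − 2)) = L^{j+1−i} − (L+1)∕2 ≤ L^{j+1−i} − 2`. [cite: Balaban1987RG1, (0.3) p.252] -/
theorem mem_family_of_mem_succ {j i : ℕ} (hj : j + 1 ≤ P.m + P.K) (hij : i + 1 ≤ j) (z : Site P (j + 1))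
    (c : PBond P (i + 1))
    (hc : c ∈ univ.filter (fun c : PBond P (i + 1) => ∀ κ, ((c.src κ -
        (((z κ).val * P.L ^ (j + 1 - (i + 1)) + (P.L ^ (j + 1 - (i + 1)) - 1) / 2 : ℕ) : ZMod (P.sitesPerDir (i + 1)))).valMinAbs).natAbs
          ≤ P.L ^ (j + 1 - (i + 1)) - 2))
    (b : PBond P i) (hb : blockOf b.src = c.src ∨ blockOf b.src = c.tgt) :
    b ∈ univ.filter (fun b : PBond P i => ∀ κ, ((b.src κ -
        (((z κ).val * P.L ^ (j + 1 - i) + (P.L ^ (j + 1 - i) - 1) / 2 : ℕ) : ZMod (P.sitesPerDir i))).valMinAbs).natAbs ≤ P.L ^ (j + 1 - i) - 2) := by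
  have hL := T4ReflectionCone.three_le_L P
  have hi : i + 1 ≤ P.m + P.K := by omega
  rw [Finset.mem_filter] at hc ⊢
  refine ⟨Finset.mem_univ _, fun κ => ?_⟩
  set r : ℕ := j - i with hr
  have hr1 : j + 1 - (i + 1) = r := by omega
  have hr2 : j + 1 - i = r + 1 := by omega
  rw [hr1] at hc
  rw [hr2]
  -- the level-`i` centre is `emb` of the level-`(i+1)` centre
  have hzlt : ∀ κ, (z κ).val < P.sitesPerDir (i + 1 + r) := fun κ => by
    rw [show i + 1 + r = j + 1 by omega]; exact ZMod.val_lt _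
  have hcen := emb_centre (P := P) (i := i) (r := r) (by omega) (fun κ => (z κ).val) hzlt
  have hcenκ : (((z κ).val * P.L ^ (r + 1) + (P.L ^ (r + 1) - 1) / 2 : ℕ) : ZMod (P.sitesPerDir i))
      = emb (fun κ => (((z κ).val * P.L ^ r + (P.L ^ r - 1) / 2 : ℕ) : ZMod (P.sitesPerDir (i + 1)))) κ := by
    rw [hcen]
  -- the three legs
  have h1 : ((b.src κ - emb (blockOf b.src) κ).valMinAbs).natAbs ≤ (P.L - 1) / 2 := natAbs_valMinAbs_sub_emb_blockOf_le hi b.src κ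
  have h2 : ((blockOf b.src κ - c.src κ).valMinAbs).natAbs ≤ 1 := by
    rcases hb with hb | hb
    · rw [hb, sub_self, ZMod.valMinAbs_zero]; simp
    · rw [hb]; exact natAbs_valMinAbs_shift_sub_le c.src c.dir κ
  have h3 := hc.2 κ
  have h23 : ((blockOf b.src κ - (((z κ).val * P.L ^ r + (P.L ^ r - 1) / 2 : ℕ) : ZMod (P.sitesPerDir (i + 1)))).valMinAbs).natAbs
      ≤ 1 + (P.L ^ r - 2) := (natAbs_valMinAbs_sub_le _ (c.src κ) _).trans (add_le_add h2 h3)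
  have h23' := natAbs_valMinAbs_emb_sub_emb_le hi (blockOf b.src)
    (fun κ => (((z κ).val * P.L ^ r + (P.L ^ r - 1) / 2 : ℕ) : ZMod (P.sitesPerDir (i + 1)))) κ
  have htot := (natAbs_valMinAbs_sub_le (b.src κ) (emb (blockOf b.src) κ)
    (emb (fun κ => (((z κ).val * P.L ^ r + (P.L ^ r - 1) / 2 : ℕ) : ZMod (P.sitesPerDir (i + 1)))) κ)).trans (add_le_add h1 h23')
  rw [hcenκ]
  -- arithmetic: `(L−1)/2 + L·(1 + (L^r − 2)) ≤ L^{r+1} − 2` for `L ≥ 3`, `r ≥ 1`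
  have hL2 := AveragingRT.two_mul_half_add_one P
  have hrpos : 1 ≤ r := by omega
  have hLr : 3 ≤ P.L ^ r := le_trans hL (by simpa using Nat.pow_le_pow_right P.L_pos hrpos)
  have hmul : P.L * ((blockOf b.src κ - (((z κ).val * P.L ^ r + (P.L ^ r - 1) / 2 : ℕ) : ZMod (P.sitesPerDir (i + 1)))).valMinAbs).natAbs
      ≤ P.L * (1 + (P.L ^ r - 2)) := Nat.mul_le_mul_left _ h23
  have key : (P.L - 1) / 2 + P.L * (1 + (P.L ^ r - 2)) ≤ P.L ^ (r + 1) - 2 := by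
    have e1 : P.L * (1 + (P.L ^ r - 2)) = P.L * P.L ^ r - P.L := by
      rw [show 1 + (P.L ^ r - 2) = P.L ^ r - 1 by omega, Nat.mul_sub, mul_one]
    have e2 : P.L ^ (r + 1) = P.L * P.L ^ r := pow_succ' _ _
    have hX : 3 * P.L ≤ P.L * P.L ^ r := by rw [mul_comm]; exact Nat.mul_le_mul_left _ hLr
    rw [e1, e2]
    omega
  calc _ ≤ (P.L - 1) / 2 + P.L * ((blockOf b.src κ - (((z κ).val * P.L ^ r + (P.L ^ r - 1) / 2 : ℕ) :
        ZMod (P.sitesPerDir (i + 1)))).valMinAbs).natAbs := htot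
    _ ≤ (P.L - 1) / 2 + P.L * (1 + (P.L ^ r - 2)) := Nat.add_le_add_left hmul _
    _ ≤ P.L ^ (r + 1) - 2 := key

/-! ## §2 The level-0 ball: the bottom centre of `z` is lit `B15DeterminingSets.embIter (j+1) z` -/

/-- ★ **LEVEL-0 BALL**: a bond of `C^z_0` issues within `L^{j+1} − 2` of `embIter (j+1) z`, coordinatewise (the shape N4 consumes).
[cite: Balaban1987RG1, (0.1) p.251] -/
theorem natAbs_valMinAbs_sub_embIter_le_of_mem_family_zero {j : ℕ} (hj : j + 1 ≤ P.m + P.K) (z : Site P (j + 1)) (b : PBond P 0)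
    (hb : b ∈ univ.filter (fun b : PBond P 0 => ∀ κ, ((b.src κ -
        (((z κ).val * P.L ^ (j + 1 - 0) + (P.L ^ (j + 1 - 0) - 1) / 2 : ℕ) : ZMod (P.sitesPerDir 0))).valMinAbs).natAbs ≤ P.L ^ (j + 1 - 0) - 2))
    (κ : Fin P.d) :
    ((b.src κ - B15DeterminingSets.embIter (j + 1) z κ).valMinAbs).natAbs ≤ P.L ^ (j + 1) - 2 := by
  rw [Finset.mem_filter, Nat.sub_zero] at hb
  rw [embIter_eq_centre (j + 1) hj z]
  exact hb.2 κ

/-! ## §3 Multiplicity: a level-`i` bond lies in `C^z_i` for at most `2^d` top sites `z` (`i ≤ j`, top level `j + 1`) -/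

/-- **ONE COORDINATE**: among the centres `vM + (M−1)∕2` (`M = L^{j+1−i} ≥ 3`, `v : ZMod (sitesPerDir (j+1))`) at most TWO lie within torus distance `M − 2` of a given
`x : ZMod (sitesPerDir i)` — they are spaced `M` apart and `2(M − 2) + 1 < 2M`; precisely `v ∈ {q, q−1}` or `v ∈ {q, q+1}` with `q = x.val ∕ M` according to the position of
`x` in its block. [folklore] -/
theorem card_filter_near_centre_le_two {j i : ℕ} (hj : j + 1 ≤ P.m + P.K) (hij : i ≤ j) (x : ZMod (P.sitesPerDir i)) :
    (univ.filter (fun v : ZMod (P.sitesPerDir (j + 1)) =>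
        ((x - ((v.val * P.L ^ (j + 1 - i) + (P.L ^ (j + 1 - i) - 1) / 2 : ℕ) : ZMod (P.sitesPerDir i))).valMinAbs).natAbs ≤ P.L ^ (j + 1 - i) - 2)).card ≤ 2 := by
  have hL := T4ReflectionCone.three_le_L P
  set r : ℕ := j + 1 - i with hr
  set M : ℕ := P.L ^ r with hM
  set hh : ℕ := (M - 1) / 2 with hhh
  have hM2 : 2 * hh + 1 = M := by rw [hhh, hM]; exact (pow_eq_two_mul_half_add_one P r).symm
  have hM3 : 3 ≤ M := le_trans hL (by rw [hM]; simpa using Nat.pow_le_pow_right P.L_pos (show 1 ≤ r by omega))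
  have hN : P.sitesPerDir i = P.sitesPerDir (j + 1) * M := by
    have := sitesPerDir_eq_mul_pow P (i := i) (r := r) (by omega)
    rwa [show i + r = j + 1 by omega] at this
  set N' : ℕ := P.sitesPerDir (j + 1) with hN'
  -- the block index and offset of `x`
  set q : ℕ := x.val / M with hq
  set ρ : ℕ := x.val % M with hρ
  have hxv : x.val / M * M + x.val % M = x.val := Nat.div_add_mod' _ _
  have hρM : ρ < M := Nat.mod_lt _ (by omega)
  -- every near centre is `q − w` with `w ∈ {−1, 0, 1}`, and the sign of `w` is decided by `ρ`
  have key : ∀ v : ZMod N', ((x - ((v.val * M + hh : ℕ) : ZMod (P.sitesPerDir i))).valMinAbs).natAbs ≤ M - 2 →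
      ∃ w : ℤ, (v : ZMod N') = (((q : ℤ) - w : ℤ) : ZMod N') ∧ -1 ≤ w ∧ w ≤ 1 ∧ (w = 1 → ρ + 2 ≤ hh) ∧ (w = -1 → hh + 2 ≤ ρ) := by
    intro v hv
    set t : ℤ := (x - ((v.val * M + hh : ℕ) : ZMod (P.sitesPerDir i))).valMinAbs with ht
    -- `t ≡ x.val − (vM + hh) (mod N = N′M)`
    have h1 : (t : ZMod (P.sitesPerDir i)) = (((x.val : ℤ) - ((v.val * M + hh : ℕ) : ℤ) : ℤ) : ZMod (P.sitesPerDir i)) := by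
      rw [ht, ZMod.coe_valMinAbs]; push_cast; rw [ZMod.natCast_zmod_val]
    rw [ZMod.intCast_eq_intCast_iff_dvd_sub] at h1
    obtain ⟨s, hs⟩ := h1
    have hNz : (P.sitesPerDir i : ℤ) = (N' : ℤ) * M := by rw [hN]; push_cast; ring
    -- `t = wM + (ρ − hh)` with `w := q − v.val − N′ s`
    have htw : t = ((q : ℤ) - v.val - N' * s) * M + ((ρ : ℤ) - hh) := by
      have hx' : (x.val : ℤ) = q * M + ρ := by rw [hq, hρ]; exact_mod_cast hxv.symm
      have : ((x.val : ℤ) - ((v.val * M + hh : ℕ) : ℤ)) - t = (P.sitesPerDir i : ℤ) * s := hs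
      rw [hNz, hx'] at this
      push_cast at this
      linarith
    set w : ℤ := (q : ℤ) - v.val - N' * s with hw
    have hvw : (v : ZMod N') = (((q : ℤ) - w : ℤ) : ZMod N') := by
      have : ((q : ℤ) - w : ℤ) = v.val + N' * s := by rw [hw]; ring
      rw [this]; push_cast; rw [ZMod.natCast_zmod_val, ZMod.natCast_self, zero_mul, add_zero]
    have htabs : t.natAbs ≤ M - 2 := hv
    have ht1 : w * (M : ℤ) + ((ρ : ℤ) - hh) ≤ (M : ℤ) - 2 := by rw [← htw]; omega
    have ht2 : -((M : ℤ) - 2) ≤ w * (M : ℤ) + ((ρ : ℤ) - hh) := by rw [← htw]; omega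
    have hM0 : (0 : ℤ) ≤ (M : ℤ) := by positivity
    have hw_lo : -1 ≤ w := by
      by_contra hcon
      have hwM : w * (M : ℤ) ≤ (-2) * (M : ℤ) := mul_le_mul_of_nonneg_right (by omega) hM0
      omega
    have hw_hi : w ≤ 1 := by
      by_contra hcon
      have hwM : 2 * (M : ℤ) ≤ w * (M : ℤ) := mul_le_mul_of_nonneg_right (by omega) hM0
      omega
    refine ⟨w, hvw, hw_lo, hw_hi, fun h1 => ?_, fun h1 => ?_⟩
    · rw [h1, one_mul] at ht1; omega
    · rw [h1, neg_one_mul] at ht2; omega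
  -- hence the filter sits inside a two-element set
  by_cases hcase : ρ + 2 ≤ hh
  · refine le_trans (Finset.card_le_card fun v hv => ?_) (Finset.card_le_two (a := ((q : ℤ) : ZMod N')) (b := (((q : ℤ) - 1 : ℤ) : ZMod N')))
    rw [Finset.mem_filter] at hv
    obtain ⟨w, hvw, hw1, hw2, -, hB⟩ := key v hv.2
    have hw' : w ≠ -1 := fun h => by have := hB h; omega
    rw [Finset.mem_insert, Finset.mem_singleton, hvw]
    rcases (show w = 0 ∨ w = 1 by omega) with h | h
    · left; rw [h, sub_zero]
    · right; rw [h]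
  · refine le_trans (Finset.card_le_card fun v hv => ?_) (Finset.card_le_two (a := ((q : ℤ) : ZMod N')) (b := (((q : ℤ) + 1 : ℤ) : ZMod N')))
    rw [Finset.mem_filter] at hv
    obtain ⟨w, hvw, hw1, hw2, hA, -⟩ := key v hv.2
    have hw' : w ≠ 1 := fun h => by have := hA h; omega
    rw [Finset.mem_insert, Finset.mem_singleton, hvw]
    rcases (show w = 0 ∨ w = -1 by omega) with h | h
    · left; rw [h, sub_zero]
    · right; rw [h, sub_neg_eq_add]

/-- ★ **MULTIPLICITY**: a level-`i` bond lies in the support family `C^z_i` of at most `2^d` top sites `z ∈ T^{(j+1)}` (`i ≤ j`): the set of such `z` is the product over the coordinates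
of the one-coordinate sets of the previous lemma. [folklore] -/
theorem card_filter_mem_family_le {j i : ℕ} (hj : j + 1 ≤ P.m + P.K) (hij : i ≤ j) (b : PBond P i) :
    (univ.filter (fun z : Site P (j + 1) => ∀ κ, ((b.src κ -
        (((z κ).val * P.L ^ (j + 1 - i) + (P.L ^ (j + 1 - i) - 1) / 2 : ℕ) : ZMod (P.sitesPerDir i))).valMinAbs).natAbs ≤ P.L ^ (j + 1 - i) - 2)).card
      ≤ 2 ^ P.d := by
  classical
  have hset : univ.filter (fun z : Site P (j + 1) => ∀ κ, ((b.src κ -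
        (((z κ).val * P.L ^ (j + 1 - i) + (P.L ^ (j + 1 - i) - 1) / 2 : ℕ) : ZMod (P.sitesPerDir i))).valMinAbs).natAbs ≤ P.L ^ (j + 1 - i) - 2)
      = Fintype.piFinset (fun κ : Fin P.d => univ.filter (fun v : ZMod (P.sitesPerDir (j + 1)) =>
          ((b.src κ - ((v.val * P.L ^ (j + 1 - i) + (P.L ^ (j + 1 - i) - 1) / 2 : ℕ) : ZMod (P.sitesPerDir i))).valMinAbs).natAbs ≤ P.L ^ (j + 1 - i) - 2)) := by
    ext z
    simp only [Finset.mem_filter, Finset.mem_univ, true_and]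
    constructor
    · intro h
      exact Fintype.mem_piFinset.mpr fun κ => Finset.mem_filter.mpr ⟨Finset.mem_univ _, h κ⟩
    · intro h κ
      exact (Finset.mem_filter.mp (Fintype.mem_piFinset.mp h κ)).2
  rw [hset]
  calc (Fintype.piFinset (fun κ : Fin P.d => univ.filter (fun v : ZMod (P.sitesPerDir (j + 1)) =>
          ((b.src κ - ((v.val * P.L ^ (j + 1 - i) + (P.L ^ (j + 1 - i) - 1) / 2 : ℕ) : ZMod (P.sitesPerDir i))).valMinAbs).natAbs ≤ P.L ^ (j + 1 - i) - 2))).card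
      = ∏ κ : Fin P.d, (univ.filter (fun v : ZMod (P.sitesPerDir (j + 1)) =>
          ((b.src κ - ((v.val * P.L ^ (j + 1 - i) + (P.L ^ (j + 1 - i) - 1) / 2 : ℕ) : ZMod (P.sitesPerDir i))).valMinAbs).natAbs ≤ P.L ^ (j + 1 - i) - 2)).card :=
        Fintype.card_piFinset _
    _ ≤ ∏ _κ : Fin P.d, 2 := Finset.prod_le_prod' fun κ _ => card_filter_near_centre_le_two hj hij (b.src κ)
    _ = 2 ^ P.d := by rw [Finset.prod_const, Finset.card_univ, Fintype.card_fin]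

/-- ★★ **THE OVERLAP SUM** (the form N5∕N6 consume): `Σ_{z : T^{(j+1)}} Σ_{b ∈ C^z_i} g b ≤ 2^d · Σ_b g b` for every nonnegative weight `g` on the level-`i` bonds (`i ≤ j`).
[folklore] -/
theorem sum_sum_family_le {j i : ℕ} (hj : j + 1 ≤ P.m + P.K) (hij : i ≤ j) (g : PBond P i → ℝ) (hg : ∀ b, 0 ≤ g b) :
    ∑ z : Site P (j + 1), ∑ b ∈ univ.filter (fun b : PBond P i => ∀ κ, ((b.src κ -
        (((z κ).val * P.L ^ (j + 1 - i) + (P.L ^ (j + 1 - i) - 1) / 2 : ℕ) : ZMod (P.sitesPerDir i))).valMinAbs).natAbs ≤ P.L ^ (j + 1 - i) - 2), g b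
      ≤ 2 ^ P.d * ∑ b : PBond P i, g b := by
  classical
  -- write the inner sum as an indicator sum and exchange
  have h1 : ∀ z : Site P (j + 1), ∑ b ∈ univ.filter (fun b : PBond P i => ∀ κ, ((b.src κ -
        (((z κ).val * P.L ^ (j + 1 - i) + (P.L ^ (j + 1 - i) - 1) / 2 : ℕ) : ZMod (P.sitesPerDir i))).valMinAbs).natAbs ≤ P.L ^ (j + 1 - i) - 2), g b
      = ∑ b : PBond P i, if (∀ κ, ((b.src κ -
        (((z κ).val * P.L ^ (j + 1 - i) + (P.L ^ (j + 1 - i) - 1) / 2 : ℕ) : ZMod (P.sitesPerDir i))).valMinAbs).natAbs ≤ P.L ^ (j + 1 - i) - 2) then g b else 0 :=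
    fun z => Finset.sum_filter _ _
  simp_rw [h1]
  rw [Finset.sum_comm, Finset.mul_sum]
  refine Finset.sum_le_sum fun b _ => ?_
  rw [← Finset.sum_filter, Finset.sum_const, nsmul_eq_mul]
  have hc := card_filter_mem_family_le hj hij b
  have : ((univ.filter (fun z : Site P (j + 1) => ∀ κ, ((b.src κ -
        (((z κ).val * P.L ^ (j + 1 - i) + (P.L ^ (j + 1 - i) - 1) / 2 : ℕ) : ZMod (P.sitesPerDir i))).valMinAbs).natAbs ≤ P.L ^ (j + 1 - i) - 2)).card : ℝ)
      ≤ (2 : ℝ) ^ P.d := by exact_mod_cast hc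
  exact mul_le_mul_of_nonneg_right this (hg b)

end Summit.QuantumFields.YangMills.Theorems.Prop7TrueLinSparseSupport
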